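import Mathlib
import Summits.Ventures.PercRepro2.SwOutCrossJunctionOrbit
import Summits.Ventures.PercRepro2.SwOutJunctionH1Orbit
import Summits.Ventures.PercRepro2.SwOutBlocks

/-!
# THEOREM A_cross: the rigid inequality on every cross-junction class (blind cell PercRepro2,
night-4 g24, 2026-08-28; proofs/NIGHT4-G24.md §7)

A base region `U ∋ h` (`l ∉ U`) with a CROSS JUNCTION `u` whose neighbours are adjacent to `h` or
are DROPPED VERTICES `p i` forming one component along the simple cross-edge graph `G`
(`CrossJunction`, boundary (iv) of Theorem A_mix).  THE KEY of a `Q`-point (`keyX`) is a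
CONFIGURATION: the base `baseX ζ` read off the point when the point is of the MIXED KIND
(`MixedKindX`: it lies in the block of the base of some core-kind `Q`-point of the class), else
the all-red orientation; THE BLOCKS (`blockOfX`) are the block `blockX` of the base or the coarse
orbit.  Every `Q`-point lies in the block of its key (`mem_blockOfX_keyX`: a core-kind point is
in the block of its own base, `mem_blockX_baseX`; a point that is not of the mixed kind is
core-free), every `Q`-point of that block lies in the class with the same key
(`keyX_eq_of_mem_blockOfX`: along a block the base is read off every point — the reading lemma
`baseX_crossReal` — and every point is in the outside class; along a plain orbit a point of the
mixed kind would put the original point into the same block by the orbit closure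
`exists_crossReal_of_mem_orbit`), and every block satisfies the rigid inequality
(`card_blockOfX_le`: `card_blockX_le`, `card_orbit_le`); `rigidOK_of_blocks` assembles them:
**`rigidOK_of_crossJunction`**.
-/

namespace Summit.Ventures.PercRepro2

namespace CrossArm

open Hull LocRows

variable {V : Type*} {E : Type*} [Fintype E] [DecidableEq E]

open scoped Classical

variable {ends : E → Sym2 V} {X : Type*} [Fintype X] {U : Set V} {ξ : Config E} {l h o u : V}
  {p : X → V} {G : SimpleGraph X} [DecidableRel G.Adj]

section Key

variable (ends) (U) (ξ) (l h o u) (p) (G)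

/-- The points of the mixed kind: in the block of the base of some core-kind `Q`-point of the
class. -/
def MixedKindX (ζ : Config E) : Prop :=
  ∃ ζ₀ ∈ swOutSide ends l h o U ξ, CoreKind ends U h u ζ₀ ∧
    ζ ∈ blockX ends h u p G (baseX ends h u p ζ₀)

/-- The keys: an all-red orientation or a base. -/
abbrev KeyX (E : Type*) := Config E ⊕ Config E

/-- The key of a `Q`-point of a cross-junction class. -/
noncomputable def keyX (ζ : Config E) : KeyX E :=
  if MixedKindX ends U ξ l h o u p G ζ then Sum.inr (baseX ends h u p ζ)
  else Sum.inl (allRed ends ζ h)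

/-- The block of a key: the coarse orbit or the block of the base. -/
noncomputable def blockOfX : KeyX E → Finset (Config E)
  | Sum.inl ζ₀ => orbit ends ζ₀ h
  | Sum.inr σ => blockX ends h u p G σ

variable {ends U ξ l h o u p G}

/-- The key of a point of the mixed kind. -/
lemma keyX_of_mixed {ζ : Config E} (hm : MixedKindX ends U ξ l h o u p G ζ) :
    keyX ends U ξ l h o u p G ζ = Sum.inr (baseX ends h u p ζ) := by
  simp only [keyX, if_pos hm]

/-- The key of a point not of the mixed kind. -/
lemma keyX_of_plain {ζ : Config E} (hm : ¬ MixedKindX ends U ξ l h o u p G ζ) :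
    keyX ends U ξ l h o u p G ζ = Sum.inl (allRed ends ζ h) := by
  simp only [keyX, if_neg hm]

omit [DecidableEq E] in
/-- Membership in the block of a base. -/
lemma mem_blockX_iff {σ ζ : Config E} :
    ζ ∈ blockX ends h u p G σ ↔
      ∃ q : PtXG (ιX ends h u p σ) (κX ends h u p σ) X G, (¬ LeakRX G q ∧ ¬ LeakBX G q) ∧
        crossReal ends u (UX ends h u p σ) p G (FX ends h u p σ) σ q = ζ := by
  simp only [blockX, blockCX, Finset.mem_image, Finset.mem_filter, Finset.mem_univ, true_and]

end Key

section Thm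

variable (hj : CrossJunction ends U h u p G o) (hl : l ∉ U) (hG : G.Connected)
include hj hl hG

section Block

variable {ζ₀ : Config E} (hζ₀ : ζ₀ ∈ swOutSide ends l h o U ξ) (hk₀ : CoreKind ends U h u ζ₀)
include hζ₀ hk₀

omit [Fintype X] [DecidableRel G.Adj] hG in
/-- The u-arms of the base are connected inside themselves. -/
lemma CrossJunction.connU_baseX (j : ιX ends h u p (baseX ends h u p ζ₀)) :
    ∀ x ∈ UX ends h u p (baseX ends h u p ζ₀) j, ∀ y ∈ UX ends h u p (baseX ends h u p ζ₀) j,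
      y ∈ cluster ends (fun e => decide (e ∈ within ends (UX ends h u p (baseX ends h u p ζ₀) j))) x := by
  obtain ⟨z, -, -, -, hz⟩ := exists_of_mem_armsC (hj.uArm_baseX hl hζ₀ hk₀ j).1
  intro x hx y hy
  change x ∈ j.1 at hx
  change y ∈ j.1 at hy
  show y ∈ cluster ends (fun e => decide (e ∈ within ends j.1)) x
  rw [hz] at hx hy ⊢
  exact MixedArms.cluster_conn_within hx hy

omit [Fintype X] [DecidableRel G.Adj] hG in
/-- The far arms of the base are connected inside themselves. -/
lemma CrossJunction.connF_baseX (k : κX ends h u p (baseX ends h u p ζ₀)) :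
    ∀ x ∈ FX ends h u p (baseX ends h u p ζ₀) k, ∀ y ∈ FX ends h u p (baseX ends h u p ζ₀) k,
      y ∈ cluster ends (fun e => decide (e ∈ within ends (FX ends h u p (baseX ends h u p ζ₀) k))) x := by
  obtain ⟨z, -, -, -, hz⟩ := exists_of_mem_armsC (hj.farArm_baseX hl hζ₀ hk₀ k).1
  intro x hx y hy
  change x ∈ k.1 at hx
  change y ∈ k.1 at hy
  show y ∈ cluster ends (fun e => decide (e ∈ within ends k.1)) x
  rw [hz] at hx hy ⊢
  exact MixedArms.cluster_conn_within hx hy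

omit hG in
/-- **The base is read off every point of the block of a core-kind point.** -/
theorem CrossJunction.baseX_eq_of_mem_blockX {ζ : Config E}
    (hζ : ζ ∈ blockX ends h u p G (baseX ends h u p ζ₀)) :
    baseX ends h u p ζ = baseX ends h u p ζ₀ := by
  obtain ⟨q, ⟨hqR, hqB⟩, rfl⟩ := mem_blockX_iff.1 hζ
  exact (hj.crossBase_of_coreKind hl hζ₀ hk₀).baseX_crossReal hj.hup hj.hcross hqR hqB

omit hG in
/-- Every point of the block of a core-kind point lies in the outside class. -/
theorem CrossJunction.mem_outClass_of_mem_blockX {ζ : Config E}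
    (hζ : ζ ∈ blockX ends h u p G (baseX ends h u p ζ₀)) : ζ ∈ outClass ends U h ξ := by
  obtain ⟨q, ⟨hqR, hqB⟩, rfl⟩ := mem_blockX_iff.1 hζ
  exact hj.crossReal_mem_outClass hl hζ₀ hk₀ hqR hqB

omit hG in
/-- **The coarse orbit of a core-free point of the block stays in the block.** -/
theorem CrossJunction.mem_blockX_of_mem_orbit {ζ' : Config E}
    (hζ' : ζ' ∈ blockX ends h u p G (baseX ends h u p ζ₀)) (hc' : CoreFree ends ζ' h)
    {ζ : Config E} (hζ : ζ ∈ orbit ends (allRed ends ζ' h) h) :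
    ζ ∈ blockX ends h u p G (baseX ends h u p ζ₀) := by
  obtain ⟨q, ⟨hqR, hqB⟩, rfl⟩ := mem_blockX_iff.1 hζ'
  haveI := hj.nonempty_ιX hl hζ₀ hk₀
  obtain ⟨q', hq', hζq'⟩ := (hj.crossBase_of_coreKind hl hζ₀ hk₀).exists_crossReal_of_mem_orbit
    hj.hup hj.hcross (hj.connU_baseX hl hζ₀ hk₀) (hj.connF_baseX hl hζ₀ hk₀) hqR hqB hc' hζ
  exact mem_blockX_iff.2 ⟨q', hq', hζq'.symm⟩

end Block

/-- A `Q`-point that is not of the mixed kind is core-free. -/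
lemma CrossJunction.coreFree_of_not_mixed {ζ : Config E} (hζ : ζ ∈ swOutSide ends l h o U ξ)
    (hm : ¬ MixedKindX ends U ξ l h o u p G ζ) : CoreFree ends ζ h := by
  by_cases hu : u ∉ hull ends ζ h
  · exact coreFree_of_u_notMem_hull hj.hout hζ hu
  rw [not_not] at hu
  by_cases hk : hull ends ζ u ⊆ U
  · exfalso
    exact hm ⟨ζ, hζ, ⟨hu, hk⟩, hj.mem_blockX_baseX hl hζ ⟨hu, hk⟩ hG⟩
  · exact coreFree_of_escaping hj.hout hζ hk

/-- **Every `Q`-point lies in the block of its key.** -/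
theorem CrossJunction.mem_blockOfX_keyX {ζ : Config E} (hζ : ζ ∈ swOutSide ends l h o U ξ) :
    ζ ∈ blockOfX ends h u p G (keyX ends U ξ l h o u p G ζ) := by
  by_cases hm : MixedKindX ends U ξ l h o u p G ζ
  · rw [keyX_of_mixed hm]
    obtain ⟨ζ₀, hζ₀, hk₀, hmem⟩ := hm
    show ζ ∈ blockX ends h u p G (baseX ends h u p ζ)
    rw [hj.baseX_eq_of_mem_blockX hl hζ₀ hk₀ hmem]
    exact hmem
  · rw [keyX_of_plain hm]
    have hc : CoreFree ends ζ h := hj.coreFree_of_not_mixed hl hG hζ hm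
    obtain ⟨ω, hω⟩ := exists_orbitReal_eq (ζ₀ := allRed ends ζ h) hc rfl
    show ζ ∈ orbit ends (allRed ends ζ h) h
    simp only [orbit, Finset.mem_image, Finset.mem_univ, true_and]
    exact ⟨ω, hω⟩

/-- **Every `Q`-point of the block of a `Q`-point lies in the class with the same key.** -/
theorem CrossJunction.keyX_eq_of_mem_blockOfX {ζ : Config E} (hζ : ζ ∈ swOutSide ends l h o U ξ)
    {ζ' : Config E} (hζ' : ζ' ∈ blockOfX ends h u p G (keyX ends U ξ l h o u p G ζ))
    (hQ : ζ' ∈ tgtU ends l h {S : Set V | o ∈ S}) :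
    ζ' ∈ swOutSide ends l h o U ξ ∧ keyX ends U ξ l h o u p G ζ' = keyX ends U ξ l h o u p G ζ := by
  by_cases hm : MixedKindX ends U ξ l h o u p G ζ
  · rw [keyX_of_mixed hm] at hζ' ⊢
    obtain ⟨ζ₀, hζ₀, hk₀, hmem⟩ := hm
    have hb' : ζ' ∈ blockX ends h u p G (baseX ends h u p ζ₀) := by
      have := hζ'
      rwa [show blockOfX ends h u p G (Sum.inr (baseX ends h u p ζ)) = blockX ends h u p G (baseX ends h u p ζ)
        from rfl, hj.baseX_eq_of_mem_blockX hl hζ₀ hk₀ hmem] at this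
    have hm' : MixedKindX ends U ξ l h o u p G ζ' := ⟨ζ₀, hζ₀, hk₀, hb'⟩
    refine ⟨mem_swOutSide.2 ⟨hQ, hj.mem_outClass_of_mem_blockX hl hζ₀ hk₀ hb'⟩, ?_⟩
    rw [keyX_of_mixed hm', hj.baseX_eq_of_mem_blockX hl hζ₀ hk₀ hb',
      hj.baseX_eq_of_mem_blockX hl hζ₀ hk₀ hmem]
  · rw [keyX_of_plain hm] at hζ' ⊢
    have hc : CoreFree ends ζ h := hj.coreFree_of_not_mixed hl hG hζ hm
    have hc₀ : CoreFree ends (allRed ends ζ h) h := coreFree_allRed hc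
    have hcl₀ : allRed ends ζ h ∈ outClass ends U h ξ :=
      allRed_mem_outClass (mem_swOutSide.1 hζ).2 hc
    have hmem := hζ'
    simp only [blockOfX, orbit, Finset.mem_image, Finset.mem_univ, true_and] at hmem
    obtain ⟨ω', rfl⟩ := hmem
    have hζ'cl : orbitReal ends (allRed ends ζ h) h ω' ∈ swOutSide ends l h o U ξ :=
      mem_swOutSide.2 ⟨hQ, orbitReal_mem_outClass hc₀ hcl₀ ω'⟩
    have hc' : CoreFree ends (orbitReal ends (allRed ends ζ h) h ω') h := coreFree_orbitReal hc₀ ω'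
    have hall : allRed ends (orbitReal ends (allRed ends ζ h) h ω') h = allRed ends ζ h := by
      rw [allRed_orbitReal hc₀, allRed_idem hc]
    have hζorb : ζ ∈ orbit ends (allRed ends (orbitReal ends (allRed ends ζ h) h ω') h) h := by
      rw [hall]
      obtain ⟨ω, hω⟩ := exists_orbitReal_eq (ζ₀ := allRed ends ζ h) hc rfl
      simp only [orbit, Finset.mem_image, Finset.mem_univ, true_and]
      exact ⟨ω, hω⟩
    -- a point of the mixed kind in the orbit would put `ζ` into its block
    have hm' : ¬ MixedKindX ends U ξ l h o u p G (orbitReal ends (allRed ends ζ h) h ω') := by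
      rintro ⟨ζ₀, hζ₀, hk₀, hmem⟩
      exact hm ⟨ζ₀, hζ₀, hk₀, hj.mem_blockX_of_mem_orbit hl hζ₀ hk₀ hmem hc' hζorb⟩
    exact ⟨hζ'cl, by rw [keyX_of_plain hm', hall]⟩

/-- **Every block of a `Q`-point satisfies the rigid inequality.** -/
theorem CrossJunction.card_blockOfX_le {ζ : Config E} (hζ : ζ ∈ swOutSide ends l h o U ξ)
    {𝓔 : Set (Set E)} (h𝓔 : IsUpperSet 𝓔) :
    ((blockOfX ends h u p G (keyX ends U ξ l h o u p G ζ)).filter fun ζ' =>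
        ζ' ∈ tgtU ends l h {S : Set V | o ∈ S} ∧ redEdges ends ζ' h ∈ 𝓔).card ≤
      ((blockOfX ends h u p G (keyX ends U ξ l h o u p G ζ)).filter fun ζ' =>
        ζ' ∈ tgtU ends l h {S : Set V | o ∈ S} ∧ blueEdges ends ζ' h ∈ 𝓔).card := by
  by_cases hm : MixedKindX ends U ξ l h o u p G ζ
  · rw [keyX_of_mixed hm]
    obtain ⟨ζ₀, hζ₀, hk₀, hmem⟩ := hm
    show ((blockX ends h u p G (baseX ends h u p ζ)).filter _).card ≤
      ((blockX ends h u p G (baseX ends h u p ζ)).filter _).card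
    rw [hj.baseX_eq_of_mem_blockX hl hζ₀ hk₀ hmem]
    exact hj.card_blockX_le hl hζ₀ hk₀ hG h𝓔
  · rw [keyX_of_plain hm]
    have hc : CoreFree ends ζ h := hj.coreFree_of_not_mixed hl hG hζ hm
    have hc₀ : CoreFree ends (allRed ends ζ h) h := coreFree_allRed hc
    have hcl₀ : allRed ends ζ h ∈ outClass ends U h ξ :=
      allRed_mem_outClass (mem_swOutSide.1 hζ).2 hc
    exact card_orbit_le hc₀ hj.hloop_h hcl₀ hl h𝓔

/-- **THEOREM A_cross: the rigid inequality on every cross-junction class**, for every outside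
colouring. -/
theorem CrossJunction.rigidOK_of_crossJunction : RigidOK ends l h o U ξ :=
  rigidOK_of_blocks ξ (keyX ends U ξ l h o u p G) (blockOfX ends h u p G)
    (fun _ hζ => hj.mem_blockOfX_keyX hl hG hζ)
    (fun _ hζ _ hζ' hQ => hj.keyX_eq_of_mem_blockOfX hl hG hζ hζ' hQ)
    (fun _ hζ _ h𝓔 => hj.card_blockOfX_le hl hG hζ h𝓔)

end Thm

end CrossArm

end Summit.Ventures.PercRepro2
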